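import Mathlib
import HarnessLib
import Literature.Analysis.FluidPDE.VectorCalculus
import Literature.Analysis.FluidPDE.VorticityCalculus
import Literature.Analysis.FluidPDE.VorticityStretching
import Literature.Analysis.FluidPDE.BiotSavartCurlPair
import Literature.Analysis.FluidPDE.BiotSavartNewtonKernel
import Literature.Analysis.FluidPDE.SverakLandauPoincare
import Summits.NavierStokesRegularity.NavierStokesRegularity.Theorems.UnthreadedDoorAntidynamoHarmonicLogGrowth
import Summits.NavierStokesRegularity.NavierStokesRegularity.Theorems.UnthreadedDoorAntidynamoSpherePathCoefficient

/-!
# Route `UnthreadedDoor` / `ThreadingFlux`, crux `PoloidalLiouville` (stmt-NavierStokesRegularity-1222), antidynamo v2 skeleton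
# (sha16 `4ebf5683127b`), WALL `stub_scalarLiouville`: the WEIGHTED SHELL-OSCILLATION BOUND for the toroidal potential
# (a far-field constraint: the non-radial part of `T` is radially mean-free at rate `O(V/R)`)

Support file (seat leafhand-ns-unthreadeddoor-2 g5, cell decomp-ns), `--supports stmt-NavierStokesRegularity-1222 --as helper`; theorems only.

THE POINT.  In the wall's class the slice `v = v(t)` is smooth and bounded, `‖v‖ ≤ V`, and its vorticity is `curl v = ∇T × (x − x₀)` off the
centre.  Then `W := v − T·(x − x₀)` is curl-free on the simply connected `ℝ³ ∖ {x₀}`, hence `W = ∇φ` (tree Poincaré lemma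
`Sverak2011.exists_gradient_eq_of_fderiv_symmetric`).  Integrate `∇φ` around the closed «sector loop» made of two radial segments
`r ↦ x₀ + r n`, `r ↦ x₀ + r n'` (`r ∈ [R₁, R₂]`) and two great-circle arcs on the spheres `S_{R₁}(x₀)`, `S_{R₂}(x₀)`: on a radial segment
`∂ᵣφ = ⟪v, n⟫ − r T`, on a sphere arc the radial field `T·(x − x₀)` is invisible and `∂ₛφ = R ⟪v, γ′⟫`.  Hence the EXACT identity
(`weightedShell_integral_eq`)

  `∫_{R₁}^{R₂} r (T(x₀ + r n) − T(x₀ + r n')) dr = ∫_{R₁}^{R₂} (⟪v(x₀+rn), n⟫ − ⟪v(x₀+rn'), n'⟫) dr + R₂ ∫₀^θ ⟪v, γ′⟫ − R₁ ∫₀^θ ⟪v, γ′⟫`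

and the bound (★ `weightedShell_oscillation_le`, ★★ `weightedShell_oscillation_le_pi` for arbitrary unit `n, n'`)

  `|∫_{R₁}^{R₂} r (T(x₀ + r n) − T(x₀ + r n')) dr| ≤ 2V(R₂ − R₁) + πV(R₁ + R₂)`.

CONSEQUENCES (★ `le_of_weightedShell_ge`, `le_div_of_dyadicShell_ge`): if `T(x₀ + rn) − T(x₀ + rn') ≥ μ` for all `r ∈ [R₁, R₂]` then
`μ R₁ (R₂ − R₁) ≤ 2V(R₂ − R₁) + πV(R₁ + R₂)`; on a dyadic shell `[R, 2R]` this is `μ ≤ (2 + 3π) V / R`.  So although the tangential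
oscillation of `T` is only `O(1)` pointwise (`osc_{S_r} T ≤ π sup‖curl v‖`, the zero-mean gauge bound of `StubToroidalPotential`), a
SIGN-COHERENT tangential oscillation cannot persist radially: the non-radial part of the potential is radially mean-free at infinity at rate
`O(V/R)`, uniformly in the directions.  This is the poloidal analogue of the obstruction `|ϖ · (ω_θ/ϖ)| ≤ C` which, paired with the spread of
positivity (KNSS 2009 Lemma 2.1, tree `KNSS2009_lemma21_halfball`), closes KNSS's Theorem 5.2: any candidate maximum-principle scalar for the
wall that is `T` modulo radial functions inherits from this file the «no large ball above the mean» half of the argument.  (Worked example in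
the seat notes: `T = cos θ` is NOT the potential of a bounded field, `T = cos r · cos θ` is.)

CONTENTS (file 1/2). §1 `curl (T·(x − x₀)) = ∇T × (x − x₀)`, the curl-free field `W`; §2 the potential `φ` (Poincaré lemma on `ℝ³ ∖ {x₀}`);
§3 FTC along radial segments and sphere arcs; §4 the sector-loop identity `weightedShell_integral_eq` and the bound
`weightedShell_oscillation_le_of_arc` for a unit-speed arc.  File 2/2 (`…WallShellMeanBounds`): great circles, every pair of unit vectors is
joined by a great-circle arc of length `≤ π`, the bounds ★/★★ and the consequences quoted above.

HONEST LABEL: slice-wise KINEMATICS of the wall's class (no time, no NS dynamics); nothing here proves `stub_scalarLiouville`, `PoloidalLiouville`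
(1222) or bears on Navier–Stokes regularity; no summit statement is proved. [folklore]
[cite: KochNadirashviliSereginSverak2009, Thm 5.2 and Lemma 2.1 (arXiv:0709.3599 pp. 5, 9–10)] [cite: Sverak2011, §4 (Poincaré lemma off a point)]
-/

noncomputable section

-- the summit and its single sub-problem share the name (CONVENTIONS §1)
set_option linter.dupNamespace false

open scoped Topology InnerProductSpace RealInnerProductSpace ContDiff
open Filter Set Function Metric MeasureTheory intervalIntegral
open Literature.Analysis.FluidPDE

namespace Summit.NavierStokesRegularity.NavierStokesRegularity.Theorems.PoloidalLiouville.Antidynamo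

namespace ShellMean

/-! ### §1 The curl-free field `W = v − T·(x − x₀)` -/

/-- `curl (x ↦ T x • (x − x₀)) = ∇T × (x − x₀)` at a point of differentiability of `T`. [folklore] -/
theorem curl_smul_sub_centre {T : EuclideanSpace ℝ (Fin 3) → ℝ} {x₀ x : EuclideanSpace ℝ (Fin 3)}
    (hT : DifferentiableAt ℝ T x) :
    curl (fun z => T z • (z - x₀)) x = cross (gradient T x) (x - x₀) := by
  have hid : DifferentiableAt ℝ (fun z : EuclideanSpace ℝ (Fin 3) => z - x₀) x :=
    differentiableAt_id.sub_const x₀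
  rw [curl_smul hT hid]
  have h0 : curl (fun z : EuclideanSpace ℝ (Fin 3) => z - x₀) x = 0 := by
    rw [curl_eq_curlCLM, fderiv_sub_const, fderiv_fun_id]
    ext i; fin_cases i <;> simp [curlCLM_apply]
  rw [h0, smul_zero, zero_add, fderiv_eq_innerSL_gradient, curlCLM_smulRight_innerSL]

/-- `W = v − T·(x − x₀)` is curl-free where `curl v = ∇T × (x − x₀)`. [folklore] -/
theorem curl_sub_smul_eq_zero {v : EuclideanSpace ℝ (Fin 3) → EuclideanSpace ℝ (Fin 3)}
    {T : EuclideanSpace ℝ (Fin 3) → ℝ} {x₀ x : EuclideanSpace ℝ (Fin 3)}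
    (hv : DifferentiableAt ℝ v x) (hT : DifferentiableAt ℝ T x)
    (hcurl : curl v x = cross (gradient T x) (x - x₀)) :
    curl (fun z => v z - T z • (z - x₀)) x = 0 := by
  have hrad : DifferentiableAt ℝ (fun z : EuclideanSpace ℝ (Fin 3) => T z • (z - x₀)) x :=
    hT.smul (differentiableAt_id.sub_const x₀)
  rw [curl_sub hv hrad, curl_smul_sub_centre hT, hcurl, sub_self]

/-! ### §2 The potential `φ` of `W` on `ℝ³ ∖ {x₀}` -/

/-- `x₀ + y ≠ x₀` for `y ≠ 0`, in the form used for translations. [folklore] -/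
theorem add_ne_of_ne_zero {x₀ y : EuclideanSpace ℝ (Fin 3)} (hy : y ≠ 0) : y + x₀ ≠ x₀ := by
  intro h
  apply hy
  simpa using congrArg (fun z => z - x₀) h

/-- ★ **The potential.**  For `v ∈ C^∞(ℝ³)`, `T ∈ C^∞(ℝ³ ∖ {x₀})` with `curl v = ∇T × (x − x₀)` off `x₀`, there is `φ` with
`Dφ(x) = ⟪v x − T x • (x − x₀), ·⟫` at every `x ≠ x₀` (Poincaré lemma on the simply connected `ℝ³ ∖ {x₀}`, tree
`Sverak2011.exists_gradient_eq_of_fderiv_symmetric`, after translating `x₀` to the origin). [cite: Sverak2011, §4] -/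
theorem exists_potential {v : EuclideanSpace ℝ (Fin 3) → EuclideanSpace ℝ (Fin 3)}
    {T : EuclideanSpace ℝ (Fin 3) → ℝ} {x₀ : EuclideanSpace ℝ (Fin 3)}
    (hv : ContDiff ℝ (⊤ : ℕ∞) v) (hT : ContDiffOn ℝ (⊤ : ℕ∞) T {x₀}ᶜ)
    (hcurl : ∀ x, x ≠ x₀ → curl v x = cross (gradient T x) (x - x₀)) :
    ∃ φ : EuclideanSpace ℝ (Fin 3) → ℝ,
      ∀ x, x ≠ x₀ → HasFDerivAt φ (innerSL ℝ (v x - T x • (x - x₀))) x := by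
  have hO : IsOpen (({x₀}ᶜ : Set (EuclideanSpace ℝ (Fin 3)))) := isOpen_compl_singleton
  set W : EuclideanSpace ℝ (Fin 3) → EuclideanSpace ℝ (Fin 3) := fun z => v z - T z • (z - x₀) with hW
  set W₀ : EuclideanSpace ℝ (Fin 3) → EuclideanSpace ℝ (Fin 3) := fun y => W (y + x₀) with hW₀
  -- smoothness of `W` off `x₀` and of `W₀` off `0`
  have hWs : ContDiffOn ℝ (⊤ : ℕ∞) W ({x₀}ᶜ) :=
    hv.contDiffOn.sub (hT.smul (contDiffOn_id.sub contDiffOn_const))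
  have htr : ContDiff ℝ (⊤ : ℕ∞) (fun y : EuclideanSpace ℝ (Fin 3) => y + x₀) := contDiff_id.add contDiff_const
  have hmaps : MapsTo (fun y : EuclideanSpace ℝ (Fin 3) => y + x₀) {y | y ≠ 0} ({x₀}ᶜ) :=
    fun y hy => add_ne_of_ne_zero hy
  have hW₀s : ContDiffOn ℝ (⊤ : ℕ∞) W₀ {y | y ≠ 0} := hWs.comp htr.contDiffOn hmaps
  -- `W` and `W₀` are curl-free, so `DW₀` is symmetric
  have hWd : ∀ x, x ≠ x₀ → DifferentiableAt ℝ W x := fun x hx =>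
    (hWs.contDiffAt (hO.mem_nhds hx)).differentiableAt (by simp)
  have hTd : ∀ x, x ≠ x₀ → DifferentiableAt ℝ T x := fun x hx =>
    (hT.contDiffAt (hO.mem_nhds hx)).differentiableAt (by simp)
  have hcW : ∀ x, x ≠ x₀ → curl W x = 0 := fun x hx =>
    curl_sub_smul_eq_zero (hv.differentiable (by simp) x) (hTd x hx) (hcurl x hx)
  have hcW₀ : ∀ y : EuclideanSpace ℝ (Fin 3), y ≠ 0 → curlCLM (fderiv ℝ W₀ y) = 0 := by
    intro y hy
    rw [hW₀, fderiv_comp_add_right, ← curl_eq_curlCLM]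
    exact hcW _ (add_ne_of_ne_zero hy)
  have hsymm : ∀ y : EuclideanSpace ℝ (Fin 3), y ≠ 0 → ∀ h k : EuclideanSpace ℝ (Fin 3),
      ⟪fderiv ℝ W₀ y h, k⟫ = ⟪fderiv ℝ W₀ y k, h⟫ := by
    intro y hy h k
    rw [inner_clm_comm_of_curlCLM_eq_zero (hcW₀ y hy) h k, real_inner_comm]
  obtain ⟨Φ₀, -, hΦ₀⟩ := Sverak2011.exists_gradient_eq_of_fderiv_symmetric hW₀s hsymm
  refine ⟨fun x => Φ₀ (x - x₀), fun x hx => ?_⟩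
  have hy : x - x₀ ≠ 0 := sub_ne_zero.mpr hx
  have h := (hΦ₀ (x - x₀) hy).comp x (hasFDerivAt_sub_const x₀)
  rw [ContinuousLinearMap.comp_id] at h
  have hWx : W₀ (x - x₀) = v x - T x • (x - x₀) := by
    simp [hW₀, hW, sub_add_cancel]
  rw [hWx] at h
  exact h

/-! ### §3 FTC along radial segments and along sphere arcs -/

/-- `x₀ + r • n ≠ x₀` for `r ≠ 0` and a unit vector `n`. [folklore] -/
theorem centre_add_smul_ne {x₀ n : EuclideanSpace ℝ (Fin 3)} (hn : ‖n‖ = 1) {r : ℝ} (hr : r ≠ 0) :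
    x₀ + r • n ≠ x₀ := by
  intro h
  have h1 : r • n = 0 := by simpa using h
  rcases smul_eq_zero.mp h1 with h2 | h2
  · exact hr h2
  · rw [h2, norm_zero] at hn; exact zero_ne_one hn

/-- ★ **FTC along a radial segment**: with `Dφ = ⟪v − T·(x − x₀), ·⟫` off `x₀`, for a unit `n` and `0 < R₁ ≤ R₂`,
`∫_{R₁}^{R₂} (⟪v(x₀ + rn), n⟫ − r T(x₀ + rn)) dr = φ(x₀ + R₂n) − φ(x₀ + R₁n)`. [folklore] -/
theorem radial_integral_eq {v : EuclideanSpace ℝ (Fin 3) → EuclideanSpace ℝ (Fin 3)}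
    {T : EuclideanSpace ℝ (Fin 3) → ℝ} {x₀ : EuclideanSpace ℝ (Fin 3)} {φ : EuclideanSpace ℝ (Fin 3) → ℝ}
    (hvc : Continuous v) (hTc : ContinuousOn T {x₀}ᶜ)
    (hφ : ∀ x, x ≠ x₀ → HasFDerivAt φ (innerSL ℝ (v x - T x • (x - x₀))) x)
    {n : EuclideanSpace ℝ (Fin 3)} (hn : ‖n‖ = 1) {R₁ R₂ : ℝ} (hR₁ : 0 < R₁) (hR : R₁ ≤ R₂) :
    ∫ r in R₁..R₂, (⟪v (x₀ + r • n), n⟫ - r * T (x₀ + r • n)) = φ (x₀ + R₂ • n) - φ (x₀ + R₁ • n) := by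
  have hderiv : ∀ r ∈ uIcc R₁ R₂,
      HasDerivAt (fun s : ℝ => φ (x₀ + s • n)) (⟪v (x₀ + r • n), n⟫ - r * T (x₀ + r • n)) r := by
    intro r hr
    rw [uIcc_of_le hR] at hr
    have hr0 : r ≠ 0 := (lt_of_lt_of_le hR₁ hr.1).ne'
    have hin : HasDerivAt (fun s : ℝ => x₀ + s • n) n r := by
      simpa using ((hasDerivAt_id r).smul_const n).const_add x₀
    have h := (hφ _ (centre_add_smul_ne hn hr0)).comp_hasDerivAt r hin
    refine h.congr_deriv ?_
    rw [innerSL_apply_apply, inner_sub_left, add_sub_cancel_left, inner_smul_left, inner_smul_left,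
      real_inner_self_eq_norm_sq, hn]
    simp; ring
  have hcont : ContinuousOn (fun r : ℝ => ⟪v (x₀ + r • n), n⟫ - r * T (x₀ + r • n)) (uIcc R₁ R₂) := by
    have hpath : Continuous fun r : ℝ => x₀ + r • n := continuous_const.add (continuous_id.smul continuous_const)
    refine ((hvc.comp hpath).continuousOn.inner continuousOn_const).sub
      (continuousOn_id.mul (hTc.comp hpath.continuousOn fun r hr => ?_))
    rw [uIcc_of_le hR] at hr
    exact centre_add_smul_ne hn (lt_of_lt_of_le hR₁ hr.1).ne'
  exact integral_eq_sub_of_hasDerivAt hderiv (hcont.intervalIntegrable)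

/-- ★ **FTC along a sphere arc**: with `Dφ = ⟪v − T·(x − x₀), ·⟫` off `x₀`, for a differentiable unit curve `γ` with continuous velocity
and `R ≠ 0`, `∫ₐᵇ R ⟪v(x₀ + Rγ(s)), γ′(s)⟫ ds = φ(x₀ + Rγ(b)) − φ(x₀ + Rγ(a))` — the radial field `T·(x − x₀)` does no work along
the sphere (`γ ⊥ γ′`). [folklore] -/
theorem arc_integral_eq {v : EuclideanSpace ℝ (Fin 3) → EuclideanSpace ℝ (Fin 3)}
    {T : EuclideanSpace ℝ (Fin 3) → ℝ} {x₀ : EuclideanSpace ℝ (Fin 3)} {φ : EuclideanSpace ℝ (Fin 3) → ℝ}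
    (hvc : Continuous v)
    (hφ : ∀ x, x ≠ x₀ → HasFDerivAt φ (innerSL ℝ (v x - T x • (x - x₀))) x)
    {γ : ℝ → EuclideanSpace ℝ (Fin 3)} (hγd : Differentiable ℝ γ) (hγc : Continuous (deriv γ))
    (hγ1 : ∀ s, ‖γ s‖ = 1) {R : ℝ} (hR : R ≠ 0) (a b : ℝ) :
    ∫ s in a..b, R * ⟪v (x₀ + R • γ s), deriv γ s⟫ = φ (x₀ + R • γ b) - φ (x₀ + R • γ a) := by
  have hderiv : ∀ s ∈ uIcc a b,
      HasDerivAt (fun τ : ℝ => φ (x₀ + R • γ τ)) (R * ⟪v (x₀ + R • γ s), deriv γ s⟫) s := by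
    intro s _
    have hin : HasDerivAt (fun τ : ℝ => x₀ + R • γ τ) (R • deriv γ s) s :=
      ((hγd s).hasDerivAt.const_smul R).const_add x₀
    have h := (hφ _ (centre_add_smul_ne (hγ1 s) hR)).comp_hasDerivAt s hin
    refine h.congr_deriv ?_
    rw [innerSL_apply_apply, inner_sub_left, add_sub_cancel_left, inner_smul_right, inner_smul_left,
      inner_smul_right, inner_smul_left, inner_self_deriv_eq_zero_of_norm_eq_one hγd hγ1 s]
    simp
  have hcont : Continuous fun s : ℝ => R * ⟪v (x₀ + R • γ s), deriv γ s⟫ :=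
    continuous_const.mul ((hvc.comp (continuous_const.add (hγd.continuous.const_smul R))).inner hγc)
  exact integral_eq_sub_of_hasDerivAt hderiv (hcont.intervalIntegrable _ _)

/-! ### §4 The sector-loop identity and the bound for a unit-speed arc -/

/-- ★ **The sector-loop identity.**  With `Dφ = ⟪v − T·(x − x₀), ·⟫` off `x₀`, a differentiable unit curve `γ` with continuous velocity,
`0 < R₁ ≤ R₂` and any `θ`:
`∫_{R₁}^{R₂} r (T(x₀ + rγ0) − T(x₀ + rγθ)) dr = ∫_{R₁}^{R₂} (⟪v(x₀+rγ0), γ0⟫ − ⟪v(x₀+rγθ), γθ⟫) dr + R₂-arc − R₁-arc`,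
the arcs being `∫₀^θ Rᵢ ⟪v(x₀ + Rᵢγs), γ′s⟫ ds` (the loop integral of `∇φ` vanishes). [folklore] -/
theorem weightedShell_integral_eq {v : EuclideanSpace ℝ (Fin 3) → EuclideanSpace ℝ (Fin 3)}
    {T : EuclideanSpace ℝ (Fin 3) → ℝ} {x₀ : EuclideanSpace ℝ (Fin 3)} {φ : EuclideanSpace ℝ (Fin 3) → ℝ}
    (hvc : Continuous v) (hTc : ContinuousOn T {x₀}ᶜ)
    (hφ : ∀ x, x ≠ x₀ → HasFDerivAt φ (innerSL ℝ (v x - T x • (x - x₀))) x)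
    {γ : ℝ → EuclideanSpace ℝ (Fin 3)} (hγd : Differentiable ℝ γ) (hγc : Continuous (deriv γ))
    (hγ1 : ∀ s, ‖γ s‖ = 1) {R₁ R₂ : ℝ} (hR₁ : 0 < R₁) (hR : R₁ ≤ R₂) (θ : ℝ) :
    ∫ r in R₁..R₂, r * (T (x₀ + r • γ 0) - T (x₀ + r • γ θ)) =
      (∫ r in R₁..R₂, (⟪v (x₀ + r • γ 0), γ 0⟫ - ⟪v (x₀ + r • γ θ), γ θ⟫)) +
        (∫ s in (0 : ℝ)..θ, R₂ * ⟪v (x₀ + R₂ • γ s), deriv γ s⟫) -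
          ∫ s in (0 : ℝ)..θ, R₁ * ⟪v (x₀ + R₁ • γ s), deriv γ s⟫ := by
  have hR₂ : 0 < R₂ := lt_of_lt_of_le hR₁ hR
  have h0 := radial_integral_eq hvc hTc hφ (hγ1 0) hR₁ hR
  have hθ := radial_integral_eq hvc hTc hφ (hγ1 θ) hR₁ hR
  have hA₁ := arc_integral_eq hvc hφ hγd hγc hγ1 hR₁.ne' 0 θ
  have hA₂ := arc_integral_eq hvc hφ hγd hγc hγ1 hR₂.ne' 0 θ
  -- continuity of the pieces on `[R₁, R₂]`
  have hpath : ∀ n : EuclideanSpace ℝ (Fin 3), Continuous fun r : ℝ => x₀ + r • n := fun n =>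
    continuous_const.add (continuous_id.smul continuous_const)
  have hvn : ∀ n : EuclideanSpace ℝ (Fin 3), Continuous fun r : ℝ => ⟪v (x₀ + r • n), n⟫ := fun n =>
    (hvc.comp (hpath n)).inner continuous_const
  have hTn : ∀ s : ℝ, ContinuousOn (fun r : ℝ => r * T (x₀ + r • γ s)) (uIcc R₁ R₂) := by
    intro s
    refine continuousOn_id.mul (hTc.comp (hpath (γ s)).continuousOn fun r hr => ?_)
    rw [uIcc_of_le hR] at hr
    exact centre_add_smul_ne (hγ1 s) (lt_of_lt_of_le hR₁ hr.1).ne'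
  have hi0 : IntervalIntegrable (fun r : ℝ => ⟪v (x₀ + r • γ 0), γ 0⟫ - r * T (x₀ + r • γ 0)) volume R₁ R₂ :=
    ((hvn (γ 0)).continuousOn.sub (hTn 0)).intervalIntegrable
  have hiθ : IntervalIntegrable (fun r : ℝ => ⟪v (x₀ + r • γ θ), γ θ⟫ - r * T (x₀ + r • γ θ)) volume R₁ R₂ :=
    ((hvn (γ θ)).continuousOn.sub (hTn θ)).intervalIntegrable
  have hiv : IntervalIntegrable (fun r : ℝ => ⟪v (x₀ + r • γ 0), γ 0⟫ - ⟪v (x₀ + r • γ θ), γ θ⟫) volume R₁ R₂ :=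
    ((hvn (γ 0)).sub (hvn (γ θ))).intervalIntegrable _ _
  -- pointwise rearrangement of the integrand
  have hpt : ∀ r : ℝ, r * (T (x₀ + r • γ 0) - T (x₀ + r • γ θ)) =
      (⟪v (x₀ + r • γ θ), γ θ⟫ - r * T (x₀ + r • γ θ)) - (⟪v (x₀ + r • γ 0), γ 0⟫ - r * T (x₀ + r • γ 0)) +
        (⟪v (x₀ + r • γ 0), γ 0⟫ - ⟪v (x₀ + r • γ θ), γ θ⟫) := fun r => by ring
  simp_rw [hpt]
  rw [intervalIntegral.integral_add (hiθ.sub hi0) hiv, intervalIntegral.integral_sub hiθ hi0, h0, hθ, hA₁, hA₂]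
  ring

/-- ★ **The weighted shell-oscillation bound for a unit-speed arc.**  In the situation of `weightedShell_integral_eq`, if `‖v‖ ≤ V`,
`‖γ′‖ ≤ 1` and `θ ≥ 0`, then `|∫_{R₁}^{R₂} r (T(x₀ + rγ0) − T(x₀ + rγθ)) dr| ≤ 2V(R₂ − R₁) + Vθ(R₁ + R₂)`. [folklore] -/
theorem weightedShell_oscillation_le_of_arc {v : EuclideanSpace ℝ (Fin 3) → EuclideanSpace ℝ (Fin 3)}
    {T : EuclideanSpace ℝ (Fin 3) → ℝ} {x₀ : EuclideanSpace ℝ (Fin 3)} {φ : EuclideanSpace ℝ (Fin 3) → ℝ} {V : ℝ}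
    (hvc : Continuous v) (hV : ∀ x, ‖v x‖ ≤ V) (hTc : ContinuousOn T {x₀}ᶜ)
    (hφ : ∀ x, x ≠ x₀ → HasFDerivAt φ (innerSL ℝ (v x - T x • (x - x₀))) x)
    {γ : ℝ → EuclideanSpace ℝ (Fin 3)} (hγd : Differentiable ℝ γ) (hγc : Continuous (deriv γ))
    (hγ1 : ∀ s, ‖γ s‖ = 1) (hγ' : ∀ s, ‖deriv γ s‖ ≤ 1) {R₁ R₂ θ : ℝ} (hR₁ : 0 < R₁) (hR : R₁ ≤ R₂) (hθ : 0 ≤ θ) :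
    |∫ r in R₁..R₂, r * (T (x₀ + r • γ 0) - T (x₀ + r • γ θ))| ≤ 2 * V * (R₂ - R₁) + V * θ * (R₁ + R₂) := by
  have hR₂ : 0 < R₂ := lt_of_lt_of_le hR₁ hR
  have hV0 : 0 ≤ V := le_trans (norm_nonneg _) (hV 0)
  rw [weightedShell_integral_eq hvc hTc hφ hγd hγc hγ1 hR₁ hR θ]
  -- the radial term
  have hrad : |∫ r in R₁..R₂, (⟪v (x₀ + r • γ 0), γ 0⟫ - ⟪v (x₀ + r • γ θ), γ θ⟫)| ≤ 2 * V * (R₂ - R₁) := by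
    have h := intervalIntegral.norm_integral_le_of_norm_le_const (a := R₁) (b := R₂) (C := 2 * V)
      (f := fun r : ℝ => ⟪v (x₀ + r • γ 0), γ 0⟫ - ⟪v (x₀ + r • γ θ), γ θ⟫) (fun r _ => by
        have h1 : |⟪v (x₀ + r • γ 0), γ 0⟫| ≤ V := by
          refine (abs_real_inner_le_norm _ _).trans ?_
          rw [hγ1, mul_one]; exact hV _
        have h2 : |⟪v (x₀ + r • γ θ), γ θ⟫| ≤ V := by
          refine (abs_real_inner_le_norm _ _).trans ?_
          rw [hγ1, mul_one]; exact hV _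
        rw [Real.norm_eq_abs]
        refine (abs_sub _ _).trans ?_
        linarith)
    rw [Real.norm_eq_abs, abs_of_nonneg (sub_nonneg.mpr hR)] at h
    exact h
  -- the two arcs
  have harc : ∀ R : ℝ, 0 < R → |∫ s in (0 : ℝ)..θ, R * ⟪v (x₀ + R • γ s), deriv γ s⟫| ≤ V * θ * R := by
    intro R hR0
    have h := intervalIntegral.norm_integral_le_of_norm_le_const (a := (0 : ℝ)) (b := θ) (C := R * V)
      (f := fun s : ℝ => R * ⟪v (x₀ + R • γ s), deriv γ s⟫) (fun s _ => by
        rw [Real.norm_eq_abs, abs_mul, abs_of_pos hR0]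
        refine mul_le_mul_of_nonneg_left ?_ hR0.le
        refine (abs_real_inner_le_norm _ _).trans ?_
        calc ‖v (x₀ + R • γ s)‖ * ‖deriv γ s‖ ≤ V * 1 :=
              mul_le_mul (hV _) (hγ' s) (norm_nonneg _) hV0
          _ = V := mul_one V)
    rw [Real.norm_eq_abs, sub_zero, abs_of_nonneg hθ] at h
    calc |∫ s in (0 : ℝ)..θ, R * ⟪v (x₀ + R • γ s), deriv γ s⟫| ≤ R * V * θ := h
      _ = V * θ * R := by ring
  have h1 := harc R₁ hR₁
  have h2 := harc R₂ hR₂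
  calc |(∫ r in R₁..R₂, (⟪v (x₀ + r • γ 0), γ 0⟫ - ⟪v (x₀ + r • γ θ), γ θ⟫)) +
          (∫ s in (0 : ℝ)..θ, R₂ * ⟪v (x₀ + R₂ • γ s), deriv γ s⟫) -
            ∫ s in (0 : ℝ)..θ, R₁ * ⟪v (x₀ + R₁ • γ s), deriv γ s⟫|
        ≤ |∫ r in R₁..R₂, (⟪v (x₀ + r • γ 0), γ 0⟫ - ⟪v (x₀ + r • γ θ), γ θ⟫)| +
          |∫ s in (0 : ℝ)..θ, R₂ * ⟪v (x₀ + R₂ • γ s), deriv γ s⟫| +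
            |∫ s in (0 : ℝ)..θ, R₁ * ⟪v (x₀ + R₁ • γ s), deriv γ s⟫| := by
          refine (abs_sub _ _).trans ?_
          gcongr
          exact abs_add_le _ _
    _ ≤ 2 * V * (R₂ - R₁) + V * θ * R₂ + V * θ * R₁ := by linarith
    _ = 2 * V * (R₂ - R₁) + V * θ * (R₁ + R₂) := by ring

end ShellMean

end Summit.NavierStokesRegularity.NavierStokesRegularity.Theorems.PoloidalLiouville.Antidynamo
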